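import Summits.ResolutionOfSingularities.ResolutionOfSingularities.Theses.WeightedInvariant
import Summits.ResolutionOfSingularities.ResolutionOfSingularities.Theorems.WeightedInvariantWeightedThesisProjectiveIntegralSuffices
import Summits.ResolutionOfSingularities.ResolutionOfSingularities.Theorems.WeightedInvariantWeightedThesisFiniteBirationalTransfer
import Summits.ResolutionOfSingularities.ResolutionOfSingularities.Theorems.WeightedInvariantWeightedThesisHypersurfaceModelInfinite
import Summits.ResolutionOfSingularities.ResolutionOfSingularities.Theorems.WeightedInvariantWeightedThesisGraphClosure
import Summits.ResolutionOfSingularities.ResolutionOfSingularities.Theorems.WeightedInvariantWeightedThesisImageLocallyPrincipal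
import Summits.ResolutionOfSingularities.ResolutionOfSingularities.Theorems.WeightedInvariantWeightedThesisFiniteFieldBranch
import Summits.ResolutionOfSingularities.ResolutionOfSingularities.Theorems.WeightedInvariantWeightedThesisSeparableProjection
import Literature.AlgebraicGeometry.Resolution.QuasiProjectiveResolution
import Mathlib.AlgebraicGeometry.Morphisms.Smooth
import HarnessLib

/-!
# `WeightedInvariant.WeightedThesis` is equivalent to the resolution of HYPERSURFACES
# (crux stmt-ResolutionOfSingularities-0569, line `datum-glued-split`, lead c5)

Topic: `Summits/ResolutionOfSingularities/ResolutionOfSingularities/Theorems`. The crux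
`Theses.WeightedInvariant.WeightedThesis` is the resolution conjecture for reduced separated schemes
of finite type over PERFECT fields of characteristic `p`, every prime `p` (Disproof.lean v1.2:
faithful). The line `datum-glued-split` (leads 1, a1, c4) proved, inside its datum composition
(`Theorems/WeightedInvariantWeightedThesisOfHypersurfaceDatum.lean`, p143723), that a weighted
resolution datum is only ever CONSUMED on integral hypersurfaces of smooth separated quasi-compact
schemes. This file records the datum-free content of that reduction as a theorem about the crux
itself — the statement of the crux idea `codimension-one-suffices`
(`Cruxes/WeightedThesis/Ideas/codimension-one-suffices.md`), so far realised only through the datum: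

* `weightedThesis_iff_hypersurfaces`: `WeightedThesis` holds iff, for every prime `p`, every
  perfect field `k` of characteristic `p`, every smooth separated quasi-compact `g : Y → Spec k` and
  every integral closed subscheme `j : H ↪ Y` whose ideal sheaf is locally principal (a
  hypersurface of `Y`), `H` admits a resolution of singularities;
* `weightedThesis_iff_hypersurfaces_of_dim` (modulo the named fact `CossartPiltant2019`): the same
  with `H` of dimension `> 3` only.

Ingredients, all PROVED in the tree by the line: projective reduction
(`ProjectiveIntegralSuffices.stub_projectiveIntegralSuffices`, p86611: irreducible components, Chow's
lemma, projective closure), finite birational transfer of resolutions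
(`FiniteBirationalTransfer.stub_finiteBirationalTransfer`, p98340), hypersurface models by generic
linear projection over infinite perfect fields (`HypersurfaceModel.stub_hypersurfaceModel_infinite`,
p140615), and over every perfect field of characteristic `p` up to a proper birational modification
(`HypersurfaceModel.stub_finiteFieldBranch_of_parts`, p142081, fed by separable projective Noether
normalisation p142892, graph closures p141770 and prime divisors on regular schemes p141747). The
forward directions are the specialisation of the crux to `H → Spec k` (a closed immersion followed
by a smooth separated quasi-compact morphism is separated, locally of finite type and quasi-compact;
integral schemes are reduced).
-/

noncomputable section

set_option linter.dupNamespace false -- mandated namespace of this single-conjunct summit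

open CategoryTheory CategoryTheory.Limits AlgebraicGeometry
open Literature.AlgebraicGeometry.Resolution
open Summit.ResolutionOfSingularities.ResolutionOfSingularities.Theses.WeightedInvariant

namespace Summit.ResolutionOfSingularities.ResolutionOfSingularities.Theorems.WeightedThesis.HypersurfacesIff

/-- **The hypersurface reduction at one prime and one field**: at a prime `p` and a perfect field
`k` of characteristic `p`, if every integral hypersurface `H` (closed subscheme with locally
principal ideal sheaf) of every smooth separated quasi-compact `k`-scheme `Y` has a resolution, then
every reduced separated `k`-scheme of finite type has a resolution: projective reduction to integral
closed `Z ⊆ ℙⁿ_k`, then the line's hypersurface models — generic linear projection over infinite `k`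
(`stub_hypersurfaceModel_infinite`), graph closure of a primitive element over finite `k`
(`stub_finiteFieldBranch_of_parts`) — and finite / proper birational transfer of resolutions.
[folklore; cite: Kollar2007, Prop. 2.48 (proof); CossartPiltant2019, Prop. 4.6 (proof, Steps 1–3)] -/
theorem hasResolution_of_hypersurfaces {p : ℕ} (hp : p.Prime) (k : Type) [Field k] [CharP k p]
    [PerfectField k]
    (hH : ∀ (Y H : Scheme.{0}) (g : Y ⟶ Spec (.of k)) (j : H ⟶ Y), Smooth g → IsSeparated g →
      QuasiCompact g → IsClosedImmersion j → IsIntegral H →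
      (∀ y : Y, ∃ U : Y.affineOpens, y ∈ (U : Y.Opens) ∧ (j.ker.ideal U).IsPrincipal) →
      Scheme.HasResolution H)
    (X : Scheme.{0}) (f : X ⟶ Spec (.of k)) [IsSeparated f] [LocallyOfFiniteType f]
    [QuasiCompact f] [IsReduced X] : Scheme.HasResolution X := by
  refine ProjectiveIntegralSuffices.stub_projectiveIntegralSuffices k (fun n Z ι hι hint => ?_)
    X f ‹_› ‹_› ‹_› ‹_›
  haveI := hint
  rcases finite_or_infinite k with hk | hk
  · rcases HypersurfaceModel.stub_finiteFieldBranch_of_parts HypersurfaceModel.stub_separableProjection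
        HypersurfaceModel.stub_graphClosure HypersurfaceModel.stub_imageLocallyPrincipal
        p hp k n Z ι hι hint with hreg |
        ⟨Z', hZ', ρ, hρ, hbir, Y, H, g, j, φ, hg, hgsep, hgqc, hj, hH', hprinc, hφ, hbirφ⟩
    · exact Scheme.IsRegular.hasResolution hreg
    · haveI := hZ'; haveI := hρ; haveI := hH'
      exact Scheme.HasResolution.of_isBirational ρ hbir
        (FiniteBirationalTransfer.stub_finiteBirationalTransfer Z' H φ hφ hbirφ
          (hH Y H g j hg hgsep hgqc hj hH' hprinc))
  · obtain ⟨Y, H, g, j, φ, hg, hgsep, hgqc, hj, hH', hprinc, hφ, hbir⟩ :=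
      HypersurfaceModel.stub_hypersurfaceModel_infinite k n Z ι hι hint
    haveI := hH'
    exact FiniteBirationalTransfer.stub_finiteBirationalTransfer Z H φ hφ hbir
      (hH Y H g j hg hgsep hgqc hj hH' hprinc)

/-- **A hypersurface of a smooth separated quasi-compact scheme over a field is covered by the
crux**: for `g : Y → Spec k` smooth, separated and quasi-compact and `j : H ↪ Y` a closed immersion
with `H` integral, the structure morphism `j ≫ g` is separated, locally of finite type and
quasi-compact, and `H` is reduced. [folklore] -/
theorem hasResolution_hypersurface_of_weightedThesis (hW : WeightedThesis) {p : ℕ} (hp : p.Prime)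
    (k : Type) [Field k] [CharP k p] [PerfectField k] (Y H : Scheme.{0}) (g : Y ⟶ Spec (.of k))
    (j : H ⟶ Y) [Smooth g] [IsSeparated g] [QuasiCompact g] [IsClosedImmersion j] [IsIntegral H] :
    Scheme.HasResolution H :=
  hW p hp k H (j ≫ g) inferInstance inferInstance inferInstance inferInstance

/-- **`WeightedThesis` ⟺ resolution of hypersurfaces** (crux idea `codimension-one-suffices`, made a
theorem). Resolution of every reduced separated scheme of finite type over every perfect field of
positive characteristic `p` (all primes `p`) is EQUIVALENT to the resolution of every integral
HYPERSURFACE — closed subscheme with locally principal ideal sheaf — of every smooth separated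
quasi-compact scheme over every such field. (→) specialisation; (←) irreducible components, Chow's
lemma and projective closure reduce to integral closed `Z ⊆ ℙⁿ_k`; over infinite `k` a generic linear
projection maps `Z` finitely and birationally onto a hypersurface `H` of an open of `ℙ^{d+1}_k`,
over finite `k` the closure `Z'` of the graph of a primitive element of `K(Z)/K(ℙ^d)` (for a finite
separable projection `Z → ℙ^d`) is proper birational over `Z` and finite birational onto a
hypersurface `H` of `ℙ^d ×_k ℙ¹`; a resolution of `H` pulls back along the finite birational map
(the regular `H̃` is normal, so `H̃ ×_H Z' → H̃` is an isomorphism over a dense open and its closure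
works) and pushes down along `Z' → Z`. [folklore; cite: Kollar2007, Prop. 2.48 (proof);
Kedlaya2004, Thm 1; CossartPiltant2019, Prop. 4.6 (proof, Steps 1–3)] -/
theorem weightedThesis_iff_hypersurfaces : Summit.ResolutionOfSingularities.ResolutionOfSingularities.Theses.WeightedInvariant.WeightedThesis ↔ ∀ (p : ℕ), p.Prime → ∀ (k : Type) [Field k] [CharP k p] [PerfectField k] (Y H : AlgebraicGeometry.Scheme.{0}) (g : Y ⟶ AlgebraicGeometry.Spec (.of k)) (j : H ⟶ Y), AlgebraicGeometry.Smooth g → AlgebraicGeometry.IsSeparated g → AlgebraicGeometry.QuasiCompact g → AlgebraicGeometry.IsClosedImmersion j → AlgebraicGeometry.IsIntegral H → (∀ y : Y, ∃ U : Y.affineOpens, y ∈ (U : Y.Opens) ∧ (j.ker.ideal U).IsPrincipal) → Literature.AlgebraicGeometry.Resolution.Scheme.HasResolution H := by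
  constructor
  · intro hW p hp k _ _ _ Y H g j hg hsep hqc hj hint _
    exact hasResolution_hypersurface_of_weightedThesis hW hp k Y H g j
  · intro hH p hp k _ _ _ X f hsep hlft hqc hred
    exact hasResolution_of_hypersurfaces hp k (fun Y H g j hg hs hq hj hi hpr =>
      hH p hp k Y H g j hg hs hq hj hi hpr) X f

/-- **`WeightedThesis` ⟺ resolution of hypersurfaces of dimension `> 3`**, modulo the named fact
`CossartPiltant2019` (reduced separated schemes of finite type of dimension `≤ 3` over any field are
resolved, Cossart–Piltant 2019 Thm 1.1): in `weightedThesis_iff_hypersurfaces` the hypersurfaces `H`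
of dimension `≤ 3` are resolved unconditionally, so only those with `¬ dim H ≤ 3` need be asked for —
the codimension-one form of the minimal counterexample of Disproof.lean §3 (integral closed
`X ⊆ ℙⁿ_k` of dimension `≥ 4`). [cite: CossartPiltant2019, Thm. 1.1] -/
theorem weightedThesis_iff_hypersurfaces_of_dim : Literature.AlgebraicGeometry.Resolution.CossartPiltant2019.{0} → (Summit.ResolutionOfSingularities.ResolutionOfSingularities.Theses.WeightedInvariant.WeightedThesis ↔ ∀ (p : ℕ), p.Prime → ∀ (k : Type) [Field k] [CharP k p] [PerfectField k] (Y H : AlgebraicGeometry.Scheme.{0}) (g : Y ⟶ AlgebraicGeometry.Spec (.of k)) (j : H ⟶ Y), AlgebraicGeometry.Smooth g → AlgebraicGeometry.IsSeparated g → AlgebraicGeometry.QuasiCompact g → AlgebraicGeometry.IsClosedImmersion j → AlgebraicGeometry.IsIntegral H → (∀ y : Y, ∃ U : Y.affineOpens, y ∈ (U : Y.Opens) ∧ (j.ker.ideal U).IsPrincipal) → ¬ topologicalKrullDim H ≤ 3 → Literature.AlgebraicGeometry.Resolution.Scheme.HasResolution H) := by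
  intro hCP
  rw [weightedThesis_iff_hypersurfaces]
  refine ⟨fun h p hp k _ _ _ Y H g j hg hsep hqc hj hint hpr _ =>
    h p hp k Y H g j hg hsep hqc hj hint hpr, fun h p hp k _ _ _ Y H g j hg hsep hqc hj hint hpr => ?_⟩
  by_cases hdim : topologicalKrullDim H ≤ 3
  · haveI := hg; haveI := hsep; haveI := hqc; haveI := hj; haveI := hint
    exact hCP k H (j ≫ g) inferInstance inferInstance inferInstance inferInstance hdim
  · exact h p hp k Y H g j hg hsep hqc hj hint hpr hdim

end Summit.ResolutionOfSingularities.ResolutionOfSingularities.Theorems.WeightedThesis.HypersurfacesIff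

end
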